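/-
Copyright (c) 2026. All rights reserved.
Released under Apache 2.0 license as described in the file LICENSE.
Authors: abc-iut cell — seat abc-iut-w5-d053 (wave 5, gen 3; §4(iii) non-vacuity programme, NV-L4 rows
`FundamentalExtension.DualGraphData`, `FundamentalExtension.CombinatorialQuotient`, `CuspidalAlgorithm`,
`CuspCountData` (+ rider `CuspNumberData`) of abc-iut-w5-d197's INHABITATION-CENSUS-L4-v1; the row
`HyperbolicType` is abc-iut-w5-d197's `HyperbolicTypeNonVacuity.lean`, consumed here BY NAME).
-/
import Literature.AnabelianGeometry.AbsoluteAnabelian.AbsTopIGraphTheoreticity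
import Literature.AnabelianGeometry.AbsoluteAnabelian.AbsTopIChains
import Literature.AnabelianGeometry.AbsoluteAnabelian.FundamentalExtensionNonVacuity
import Literature.AnabelianGeometry.AbsoluteAnabelian.HyperbolicTypeNonVacuity
import HarnessLib

/-!
# Non-vacuity records for the [AbsTopI] Thm 2.14 / Lemma 4.5 / [AbsAnab] §1.3 declared-data interfaces

S. Mochizuki, *Topics in Absolute Anabelian Geometry I: Generalities* [MochizukiAbsTopI2012], Thm 2.14 p. 33
(graph-theoreticity: the dual semi-graph with compact structure `Γ` of the geometric special fibre of the stable
model, with its Galois action, and the combinatorial quotient `Π ↠ Δ^{com}`), Lemma 4.5 pp. 54–55 (cuspidal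
decomposition groups); *The absolute anabelian geometry of hyperbolic curves* [MochizukiAbsAnab2004] §0 p. 4
(the type `(g, r)`), Lemma 1.3.9 p. 19 (cusp numbers `r_V`).

abc-iut-w5-d197's kernel INHABITATION-CENSUS-L4-v1 (HOME/staging/w5/w5-d197/g2/census/, 04:2xZ) lists the
layer-L4 records `FundamentalExtension.DualGraphData`, `FundamentalExtension.CombinatorialQuotient`,
`FundamentalExtension.CuspidalAlgorithm`, `FundamentalExtension.CuspCountData`,
`FundamentalExtension.CuspNumberData` with ZERO producers: every theorem quantified over them is, today,
uninstantiated (the sixth such record, `HyperbolicType`, is witnessed in abc-iut-w5-d197's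
`HyperbolicTypeNonVacuity.lean`, whose `HyperbolicType.exists_of_isHyperbolicType` is consumed here BY NAME for
`CuspidalData.HasType`; L4-lead RULING #4h).  This PROOF-ONLY file (no `def` / `instance` / `structure`; the
witnesses live inside the theorem terms) records, with honest labels:

* `DualGraphData` — the GOOD-REDUCTION MODEL of [AbsTopI] Thm 2.14 over EVERY extension `E`: `Γ :=` one vertex
  carrying `r` open edges (the dual semi-graph with compact structure of a SMOOTH geometric special fibre with `r`
  cusps: one irreducible component, no nodes, one open edge per cusp) with the TRIVIAL Galois action (genuine
  whenever the cusps are rational over the base field) — `DualGraphData.exists_goodReductionModel`; the typed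
  CONCLUSION of Thm 2.14 (i), `InducesGraphIso`, is PROVED for every `φ` between two such models with the same `r`
  (`DualGraphData.exists_goodReductionModel_inducesGraphIso`), via the general lemma
  `inducesGraphIso_of_trivialAction` (trivial actions + isomorphic graphs ⇒ (i) for every `φ`).
* `CombinatorialQuotient` — `Δ^{com} := 1` (`CombinatorialQuotient.exists_ker_eq_top`): the good-reduction
  model again (the one-vertex semi-graph has no non-trivial finite graph-coverings), with the typed CONCLUSION of
  Thm 2.14 (ii), `CompatibleWithCombinatorialQuotients`, PROVED for every `φ`
  (`compatibleWithCombinatorialQuotients_of_ker_eq_top`); and the tautological quotient `Π ↠ Π`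
  (`exists_ker_eq_bot`, honest label: NOT the printed shape — `Δ^{com}` is a quotient of `Δ`), recording that the
  `proj_surjective` axiom is also met non-degenerately.
* `CuspidalAlgorithm` — the EMPTY algorithm (`CuspidalAlgorithm.exists_out_eq_empty`; genuine for PROPER curves,
  which have no cuspidal decomposition groups) with [AbsTopI] Lemma 4.5 (v)'s typed conclusion `RecoversCusps`
  PROVED for every cuspless cuspidal datum and REFUTED for every datum with a cusp
  (`recoversCusps_iff_isEmpty_of_out_eq_empty`); and the ALL-CLOSED-SUBGROUPS algorithm
  (`CuspidalAlgorithm.exists_out_eq_closed`), which exercises the three axioms — closedness, `Π`-conjugation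
  stability, functorial TRANSPORT along every `Π_E ≃ₜ* Π_F` — non-trivially (honest label: it does NOT recover
  the cusps of a curve with a cusp; it is a joint-satisfiability witness of the record's axioms).
* `CuspidalData.HasType` ([AbsAnab] §1.3) is met by every cuspidal datum with any genus making `(g, #cusps)`
  hyperbolic (`CuspidalData.exists_hasType`; genus `2` always works).
* `CuspCountData`, `CuspNumberData` — one-field data records: every function `Subgroup _ → ℕ` inhabits them
  (`CuspCountData.exists_d_eq`, `CuspNumberData.exists_r_eq`); with the ZERO cusp-number function no covering
  satisfies the amended total-ramification criterion of [IUTchI] Rmk 1.2.2 (i)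
  (`not_totallyRamifiedCriterion_of_r_eq_zero` — the proper case: no cusps, no total ramification at a cusp).

HONEST FRAMING: consistency / packaging facts about the cell's own interface records; the genuine dual
semi-graph of a stable model and the genuine combinatorial quotient require the étale `π₁` of a curve over an
MLF, which Mathlib does not have (FOUNDATIONS row 12); nothing of [AbsTopI] is asserted to be proved; nothing here
bears on the disputed [IUTchIII] Cor. 3.12.  A witness is consistency evidence only; instantiated ≠ endorsed.
-/

namespace Literature.AnabelianGeometry.AbsoluteAnabelian

open CategoryTheory Topology
open scoped Pointwise
open Literature.AnabelianGeometry.SemiGraphs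

universe u

namespace FundamentalExtension

variable (E : FundamentalExtension.{u}) {F : FundamentalExtension.{u}}

/-! ### The one-vertex semi-graph with `r` open edges (dual semi-graph of a smooth special fibre) -/

/-- The *cuspidal star*: a FINITE semi-graph with exactly one vertex and `r` edges, all OPEN (each edge has
exactly one branch abutting to the vertex) — the dual semi-graph with compact structure of a smooth proper
curve with `r` marked cusps ([AbsTopI] Thm 2.14: "the dual graph, together with additional open edges
corresponding to the cusps"). [cite: MochizukiAbsTopI2012, Thm 2.14 p.33] -/
theorem DualGraphData.exists_cuspidalStar (r : ℕ) :
    ∃ G : SemiGraph.{u}, Nonempty (Unique G.Vertex) ∧ Nonempty (G.Edge ≃ Fin r) ∧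
      (∀ e : G.Edge, G.IsOpenEdge e) ∧ G.IsFinite := by
  let G : SemiGraph.{u} :=
    { Vertex := PUnit.{u + 1}
      Edge := ULift.{u} (Fin r)
      Branch := ULift.{u} (Fin r) × Bool
      edgeOf := Prod.fst
      abuts := fun b => if b.2 then some PUnit.unit else none
      two_branches := fun e => ⟨(e, true), (e, false), by simp, rfl, rfl, fun b hb => by
        obtain ⟨e', c⟩ := b
        cases hb
        cases c
        · exact Or.inr rfl
        · exact Or.inl rfl⟩ }
  refine ⟨G, ⟨{ default := PUnit.unit, uniq := fun _ => rfl }⟩, ⟨Equiv.ulift⟩, fun e => ?_,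
    ⟨inferInstanceAs (Finite PUnit.{u + 1}), inferInstanceAs (Finite (ULift.{u} (Fin r)))⟩⟩
  -- the verticial portion of the edge `e` is the single branch `(e, true)`
  have hset : G.verticialPortion e = {(e, true)} := by
    ext ⟨e', c⟩
    simp only [SemiGraph.verticialPortion, Set.mem_setOf_eq, Set.mem_singleton_iff, Prod.mk.injEq, G]
    cases c <;> simp
  change Nat.card (G.verticialPortion e) < 2
  rw [hset, Nat.card_unique]
  exact Nat.one_lt_two

/-! ### [AbsTopI] Thm 2.14: `DualGraphData` — the good-reduction model, and (i) at the model -/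

/-- `DualGraphData` is inhabited over every extension: any semi-graph with the trivial Galois action.
[cite: MochizukiAbsTopI2012, Thm 2.14 p.33] -/
theorem DualGraphData.nonempty : Nonempty (DualGraphData E) :=
  let ⟨G, _⟩ := DualGraphData.exists_cuspidalStar.{u} 0
  ⟨⟨G, 1⟩⟩

/-- **The good-reduction model of [AbsTopI] Thm 2.14** over every extension `E` and every number of cusps `r`:
the dual semi-graph with compact structure is the cuspidal star (one vertex = the smooth special fibre, `r` open
edges = the cusps, finite) and "the natural action of `G`" on it is TRIVIAL (`TrivialAction`, the hypothesis
of Thm 2.14 (ii); genuine when the cusps are rational).  Honest label: the graph side is the genuine dual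
semi-graph of good reduction; that it is attached to `E` by a stable model is not expressible without étale
`π₁`. [cite: MochizukiAbsTopI2012, Thm 2.14 p.33] -/
theorem DualGraphData.exists_goodReductionModel (r : ℕ) :
    ∃ Γ : DualGraphData E, Γ.TrivialAction ∧ Nonempty (Unique Γ.graph.Vertex) ∧
      Nonempty (Γ.graph.Edge ≃ Fin r) ∧ (∀ e : Γ.graph.Edge, Γ.graph.IsOpenEdge e) ∧ Γ.graph.IsFinite := by
  obtain ⟨G, hV, hE, hopen, hfin⟩ := DualGraphData.exists_cuspidalStar.{u} r
  exact ⟨⟨G, 1⟩, fun _ => rfl, hV, hE, hopen, hfin⟩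

variable {E} in
/-- **Thm 2.14 (i) from trivial actions.** If the Galois actions on `Γ₁`, `Γ₂` are trivial and the semi-graphs
are isomorphic, then EVERY `φ : Π₁ ≅ Π₂` preserving `Δ` "induces an isomorphism of semi-graphs `φ_Γ : Γ₁ ≅ Γ₂`
compatible with the Galois actions" in the typed sense `InducesGraphIso`.
[cite: MochizukiAbsTopI2012, Thm 2.14 (i) p.33] -/
theorem inducesGraphIso_of_trivialAction {Γ₁ : DualGraphData E} {Γ₂ : DualGraphData F}
    (h₁ : Γ₁.TrivialAction) (h₂ : Γ₂.TrivialAction) (e : Γ₁.graph ≅ Γ₂.graph)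
    (φ : E.arith ≃ₜ* F.arith) (hφ : PreservesGeom φ) : InducesGraphIso Γ₁ Γ₂ φ hφ := by
  refine ⟨e, fun g => ?_⟩
  rw [h₁ g, h₂ (hφ.galEquiv g)]
  change 𝟙 _ ≫ e.hom = e.hom ≫ 𝟙 _
  simp

/-- **[AbsTopI] Thm 2.14 (i) at the good-reduction model.** For two extensions `E`, `F` and the same number of
cusps `r`, the good-reduction dual-graph data (cuspidal stars with trivial Galois action) satisfy the typed
conclusion `InducesGraphIso` for EVERY isomorphism `φ : Π_E ≅ Π_F` carrying `Δ_E` onto `Δ_F`.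
[cite: MochizukiAbsTopI2012, Thm 2.14 (i) p.33] -/
theorem DualGraphData.exists_goodReductionModel_inducesGraphIso (E F : FundamentalExtension.{u}) (r : ℕ) :
    ∃ (Γ₁ : DualGraphData E) (Γ₂ : DualGraphData F), Γ₁.TrivialAction ∧ Γ₂.TrivialAction ∧
      Nonempty (Γ₁.graph.Edge ≃ Fin r) ∧ Nonempty (Γ₂.graph.Edge ≃ Fin r) ∧
      ∀ (φ : E.arith ≃ₜ* F.arith) (hφ : PreservesGeom φ), InducesGraphIso Γ₁ Γ₂ φ hφ := by
  obtain ⟨G, -, hE, -, -⟩ := DualGraphData.exists_cuspidalStar.{u} r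
  exact ⟨⟨G, 1⟩, ⟨G, 1⟩, fun _ => rfl, fun _ => rfl, hE, hE,
    fun φ hφ => inducesGraphIso_of_trivialAction (fun _ => rfl) (fun _ => rfl) (Iso.refl G) φ hφ⟩

/-! ### [AbsTopI] Thm 2.14 (ii): `CombinatorialQuotient` — `Δ^{com} = 1`, and (ii) at the model -/

/-- **`Δ^{com} = 1` (good reduction).** Over every extension the trivial quotient `Π ↠ 1` inhabits
`CombinatorialQuotient` (its kernel is all of `Π`): the combinatorial quotient of the good-reduction model,
whose one-vertex dual semi-graph has only trivial finite graph-coverings.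
[cite: MochizukiAbsTopI2012, Thm 2.14 (ii) p.33] -/
theorem CombinatorialQuotient.exists_ker_eq_top :
    ∃ Q : CombinatorialQuotient E, Q.proj.toMonoidHom.ker = ⊤ := by
  haveI : IsTopologicalGroup PUnit.{u + 1} :=
    { continuous_mul := continuous_of_discreteTopology
      continuous_inv := continuous_of_discreteTopology }
  refine ⟨{ com := ProfiniteGrp.of PUnit.{u + 1}, proj := 1,
            proj_surjective := fun x => ⟨1, Subsingleton.elim _ _⟩ }, ?_⟩
  exact eq_top_iff.mpr fun x _ => Subsingleton.elim _ _

/-- `CombinatorialQuotient` is inhabited over every extension. [cite: MochizukiAbsTopI2012, Thm 2.14 (ii) p.33] -/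
theorem CombinatorialQuotient.nonempty : Nonempty (CombinatorialQuotient E) :=
  let ⟨Q, _⟩ := CombinatorialQuotient.exists_ker_eq_top E
  ⟨Q⟩

variable {E} in
/-- **Thm 2.14 (ii) when `Δ^{com} = 1` on both sides**: every `φ : Π₁ ≅ Π₂` "is compatible with the quotients
`Πᵢ ↠ Δᵢ^{com}`" (it carries `Ker = Π₁` onto `Ker = Π₂`). [cite: MochizukiAbsTopI2012, Thm 2.14 (ii) p.33] -/
theorem compatibleWithCombinatorialQuotients_of_ker_eq_top {Q₁ : CombinatorialQuotient E}
    {Q₂ : CombinatorialQuotient F} (h₁ : Q₁.proj.toMonoidHom.ker = ⊤) (h₂ : Q₂.proj.toMonoidHom.ker = ⊤)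
    (φ : E.arith ≃ₜ* F.arith) : CompatibleWithCombinatorialQuotients Q₁ Q₂ φ := by
  change Q₁.proj.toMonoidHom.ker.map φ.toMulEquiv.toMonoidHom = Q₂.proj.toMonoidHom.ker
  rw [h₁, h₂]
  exact Subgroup.map_top_of_surjective _ φ.surjective

/-- **[AbsTopI] Thm 2.14 (ii) at the good-reduction model**: for two extensions with `Δ^{com} = 1` the typed
conclusion `CompatibleWithCombinatorialQuotients` holds for EVERY `φ : Π_E ≅ Π_F`.
[cite: MochizukiAbsTopI2012, Thm 2.14 (ii) p.33] -/
theorem CombinatorialQuotient.exists_goodReductionModel_compatible (E F : FundamentalExtension.{u}) :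
    ∃ (Q₁ : CombinatorialQuotient E) (Q₂ : CombinatorialQuotient F),
      ∀ φ : E.arith ≃ₜ* F.arith, CompatibleWithCombinatorialQuotients Q₁ Q₂ φ := by
  obtain ⟨Q₁, h₁⟩ := CombinatorialQuotient.exists_ker_eq_top E
  obtain ⟨Q₂, h₂⟩ := CombinatorialQuotient.exists_ker_eq_top F
  exact ⟨Q₁, Q₂, fun φ => compatibleWithCombinatorialQuotients_of_ker_eq_top h₁ h₂ φ⟩

/-- The tautological quotient `Π ↠ Π` (identity; kernel `1`) also inhabits `CombinatorialQuotient`.  Honest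
label: NOT the printed shape — `Δ^{com}` is a quotient of `Δ` determined by the finite Galois coverings of `Γ`;
recorded only to show the `proj_surjective` axiom is met by a non-degenerate surjection as well.
[cite: MochizukiAbsTopI2012, Thm 2.14 (ii) p.33] -/
theorem CombinatorialQuotient.exists_ker_eq_bot :
    ∃ Q : CombinatorialQuotient E, Q.proj.toMonoidHom.ker = ⊥ :=
  ⟨{ com := E.arith, proj := ContinuousMonoidHom.id _, proj_surjective := Function.surjective_id },
    (MonoidHom.ker_eq_bot_iff _).mpr Function.injective_id⟩

variable {E} in
/-- Compatibility for the tautological quotients: every `φ` carries `Ker = 1` onto `Ker = 1`.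
[cite: MochizukiAbsTopI2012, Thm 2.14 (ii) p.33] -/
theorem compatibleWithCombinatorialQuotients_of_ker_eq_bot {Q₁ : CombinatorialQuotient E}
    {Q₂ : CombinatorialQuotient F} (h₁ : Q₁.proj.toMonoidHom.ker = ⊥) (h₂ : Q₂.proj.toMonoidHom.ker = ⊥)
    (φ : E.arith ≃ₜ* F.arith) : CompatibleWithCombinatorialQuotients Q₁ Q₂ φ := by
  change Q₁.proj.toMonoidHom.ker.map φ.toMulEquiv.toMonoidHom = Q₂.proj.toMonoidHom.ker
  rw [h₁, h₂, Subgroup.map_bot]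

/-! ### [AbsTopI] Lemma 4.5 (v): `CuspidalAlgorithm` — the empty algorithm and the all-closed algorithm -/

/-- **The EMPTY cuspidal algorithm**: assigning to every extension the empty set of "cuspidal decomposition
groups" satisfies the three axioms of `CuspidalAlgorithm` (closedness and conjugation-stability vacuously,
functorial transport because the image of `∅` is `∅`).  Genuine for PROPER hyperbolic curves (no cusps).
[cite: MochizukiAbsTopI2012, Lemma 4.5 (v) p.55] -/
theorem CuspidalAlgorithm.exists_out_eq_empty :
    ∃ A : CuspidalAlgorithm.{u}, ∀ E : FundamentalExtension.{u}, A.out E = ∅ :=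
  ⟨{ out := fun _ => ∅
     isClosed_of_mem := fun _ _ h => h.elim
     conj_mem := fun _ _ _ h => h.elim
     transport := fun _ _ _ _ => (Set.image_empty _).symm }, fun _ => rfl⟩

/-- `CuspidalAlgorithm` is inhabited. [cite: MochizukiAbsTopI2012, Lemma 4.5 (v) p.55] -/
theorem CuspidalAlgorithm.nonempty : Nonempty CuspidalAlgorithm.{u} :=
  let ⟨A, _⟩ := CuspidalAlgorithm.exists_out_eq_empty.{u}
  ⟨A⟩

/-- **Lemma 4.5 (v) for the empty algorithm**: an algorithm with empty output "recovers the cusps" of a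
cuspidal datum `C` (its output is the union of the conjugacy classes of decomposition groups of cusps) if and
only if `C` has NO cusps — proved for the proper case, refuted as soon as there is a cusp (every conjugacy class
of decomposition groups is non-empty). [cite: MochizukiAbsTopI2012, Lemma 4.5 (v) p.55] -/
theorem CuspidalAlgorithm.recoversCusps_iff_isEmpty_of_out_eq_empty {A : CuspidalAlgorithm.{u}}
    (hA : ∀ E : FundamentalExtension.{u}, A.out E = ∅) (C : CuspidalData E) :
    A.RecoversCusps E C ↔ IsEmpty C.Cusp := by
  unfold CuspidalAlgorithm.RecoversCusps
  rw [hA E]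
  constructor
  · intro h
    by_contra hne
    rw [not_isEmpty_iff] at hne
    obtain ⟨x⟩ := hne
    have hx : C.Dcusp x ∈ ⋃ y : C.Cusp, C.decompositionClass y :=
      Set.mem_iUnion.mpr ⟨x, C.Dcusp_mem_decompositionClass x⟩
    rw [← h] at hx
    exact hx
  · intro h
    exact (Set.iUnion_of_empty _).symm

/-- **The proper case, closed instance**: over every extension there are a cuspidal algorithm and a cuspidal
datum (no cusps) for which [AbsTopI] Lemma 4.5 (v)'s typed conclusion `RecoversCusps` HOLDS.
[cite: MochizukiAbsTopI2012, Lemma 4.5 (v) p.55] -/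
theorem CuspidalAlgorithm.exists_recoversCusps :
    ∃ (A : CuspidalAlgorithm.{u}) (C : CuspidalData E), IsEmpty C.Cusp ∧ A.RecoversCusps E C := by
  obtain ⟨A, hA⟩ := CuspidalAlgorithm.exists_out_eq_empty.{u}
  let C : CuspidalData E :=
    { Cusp := PEmpty.{u + 1}
      Dcusp := fun x => x.elim
      Icusp := fun x => x.elim
      Icusp_eq := fun x => x.elim
      isClosed_Dcusp := fun x => x.elim
      eq_of_conj := fun x => x.elim }
  haveI hC : IsEmpty C.Cusp := inferInstanceAs (IsEmpty PEmpty.{u + 1})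
  exact ⟨A, C, hC, (CuspidalAlgorithm.recoversCusps_iff_isEmpty_of_out_eq_empty E hA C).mpr hC⟩

variable {E} in
/-- A `Π`-conjugate of a closed subgroup of `Π` is closed (conjugation is a homeomorphism).
[cite: MochizukiAbsTopI2012, Lemma 4.5 (v) p.55] -/
theorem isClosed_conj_smul {D : Subgroup E.arith} (hD : IsClosed (D : Set E.arith)) (g : E.arith) :
    IsClosed ((MulAut.conj g • D : Subgroup E.arith) : Set E.arith) := by
  have h : ((MulAut.conj g • D : Subgroup E.arith) : Set E.arith) =
      (fun x : E.arith => g⁻¹ * x * g) ⁻¹' (D : Set E.arith) := by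
    ext x
    rw [SetLike.mem_coe, Subgroup.mem_pointwise_smul_iff_inv_smul_mem, Set.mem_preimage, SetLike.mem_coe,
      MulAut.smul_def, MulAut.conj_inv_apply]
  rw [h]
  exact hD.preimage (by fun_prop)

variable {E} in
/-- Along an isomorphism of profinite groups `α : Π_E ≅ Π_F`, the closed subgroups of `Π_F` are exactly the
images of the closed subgroups of `Π_E`. [cite: MochizukiAbsTopI2012, Lemma 4.5 (v) p.55] -/
theorem setOf_isClosed_eq_image_map (α : E.arith ≃ₜ* F.arith) :
    {D : Subgroup F.arith | IsClosed (D : Set F.arith)} =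
      (fun D : Subgroup E.arith => D.map α.toMulEquiv.toMonoidHom) ''
        {D : Subgroup E.arith | IsClosed (D : Set E.arith)} := by
  ext D'
  simp only [Set.mem_setOf_eq, Set.mem_image]
  constructor
  · intro hD'
    refine ⟨D'.comap α.toMulEquiv.toMonoidHom, ?_, ?_⟩
    · exact hD'.preimage α.continuous
    · exact Subgroup.map_comap_eq_self_of_surjective α.surjective _
  · rintro ⟨D, hD, rfl⟩
    rw [Subgroup.coe_map]
    exact α.toHomeomorph.isClosedMap _ hD

/-- **The ALL-CLOSED-SUBGROUPS algorithm**: assigning to every extension the set of ALL closed subgroups of `Π`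
satisfies the three axioms of `CuspidalAlgorithm` non-trivially — closed output, stability under
`Π`-conjugation (a homeomorphism), and functorial TRANSPORT along every `α : Π_E ≅ Π_F` (closed subgroups go to
closed subgroups and every closed subgroup of `Π_F` is hit).  Honest label: a joint-satisfiability witness of
the record's axioms; it does NOT recover the cusps of a curve (its output is far too large).
[cite: MochizukiAbsTopI2012, Lemma 4.5 (v) p.55] -/
theorem CuspidalAlgorithm.exists_out_eq_closed :
    ∃ A : CuspidalAlgorithm.{u}, ∀ (E : FundamentalExtension.{u}) (D : Subgroup E.arith),
      D ∈ A.out E ↔ IsClosed (D : Set E.arith) :=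
  ⟨{ out := fun E => {D : Subgroup E.arith | IsClosed (D : Set E.arith)}
     isClosed_of_mem := fun _ _ h => h
     conj_mem := fun _ _ g h => isClosed_conj_smul h g
     transport := fun _ _ α _ => setOf_isClosed_eq_image_map α }, fun _ _ => Iff.rfl⟩

/-- The all-closed algorithm outputs `Δ` itself (a closed subgroup) — so on an extension carrying a cuspidal
datum whose decomposition groups are all `≠ Δ` up to conjugacy it does not satisfy `RecoversCusps`; recorded
here only in the weak form "`Δ ∈ out E`". [cite: MochizukiAbsTopI2012, Lemma 4.5 (v) p.55] -/
theorem CuspidalAlgorithm.geom_mem_out_of_out_eq_closed {A : CuspidalAlgorithm.{u}}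
    (hA : ∀ (E : FundamentalExtension.{u}) (D : Subgroup E.arith), D ∈ A.out E ↔ IsClosed (D : Set E.arith)) :
    E.geom ∈ A.out E :=
  (hA E E.geom).mpr E.isClosed_geom

/-! ### [AbsAnab] §1.3: `CuspidalData.HasType` -/

/-- **`HasType` is met**: every cuspidal datum `C` on `E` has a declared type `(g, #Cusp)` for every genus `g`
with `2 < 2g + #Cusp` (e.g. `g ≥ 2` always works; for the cuspless data of a proper curve exactly `g ≥ 2`); the
type itself is abc-iut-w5-d197's `HyperbolicType.exists_of_isHyperbolicType`.
[cite: MochizukiAbsAnab2004, §1.3 p.18] -/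
theorem CuspidalData.exists_hasType (C : CuspidalData E) (g : ℕ) (h : 2 < 2 * g + Nat.card C.Cusp) :
    ∃ t : HyperbolicType, t.g = g ∧ C.HasType t := by
  obtain ⟨t, htg, htr⟩ := HyperbolicType.exists_of_isHyperbolicType g (Nat.card C.Cusp) h
  exact ⟨t, htg, htr.symm⟩

/-- In particular every cuspidal datum has a hyperbolic type of genus `2`.
[cite: MochizukiAbsAnab2004, §1.3 p.18] -/
theorem CuspidalData.exists_hasType_genus_two (C : CuspidalData E) :
    ∃ t : HyperbolicType, t.g = 2 ∧ C.HasType t :=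
  CuspidalData.exists_hasType E C 2 (by omega)

/-! ### [AbsTopI] Lemma 4.5 (iii)–(iv) / [AbsAnab] Lemma 1.3.9: `CuspCountData`, `CuspNumberData` -/

/-- `CuspCountData` packages an arbitrary function `J ↦ d(J)` (the representation theory defining `d` is not
typed; `d` enters as data). [cite: MochizukiAbsTopI2012, Lemma 4.5 (iii) p.54] -/
theorem CuspCountData.exists_d_eq {Hstar : Type u} [Group Hstar] [TopologicalSpace Hstar]
    (f : Subgroup Hstar → ℕ) : ∃ d : CuspCountData Hstar, d.d = f :=
  ⟨⟨f⟩, rfl⟩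

/-- `CuspCountData` is inhabited (e.g. by `d := 0`). [cite: MochizukiAbsTopI2012, Lemma 4.5 (iii) p.54] -/
theorem CuspCountData.nonempty {Hstar : Type u} [Group Hstar] [TopologicalSpace Hstar] :
    Nonempty (CuspCountData Hstar) :=
  ⟨⟨fun _ => 0⟩⟩

/-- `CuspNumberData` packages an arbitrary function `V ↦ r_V`. [cite: MochizukiAbsAnab2004, Lemma 1.3.9 p.19] -/
theorem CuspNumberData.exists_r_eq {D : Type u} [Group D] [TopologicalSpace D] (f : Subgroup D → ℕ) :
    ∃ c : CuspNumberData D, c.r = f :=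
  ⟨⟨f⟩, rfl⟩

/-- `CuspNumberData` is inhabited (e.g. by `r := 0`, the proper case).
[cite: MochizukiAbsAnab2004, Lemma 1.3.9 p.19] -/
theorem CuspNumberData.nonempty {D : Type u} [Group D] [TopologicalSpace D] : Nonempty (CuspNumberData D) :=
  ⟨⟨fun _ => 0⟩⟩

/-- **The proper case of the amended total-ramification criterion** ([IUTchI] Rmk 1.2.2 (i): "`Zᵢ → Wᵢ → Vᵢ`,
`Wᵢ → Vᵢ` finite étale of degree `l`, and `r_{Wᵢ} < l · r_{Vᵢ}`"): with the ZERO cusp-number function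
(no cusps at any level) NO covering satisfies the criterion — there is no cusp to be totally ramified at.
[cite: MochizukiAbsAnab2004, Lemma 1.3.9 p.19] -/
theorem not_totallyRamifiedCriterion_of_r_eq_zero {D : Type u} [Group D] [TopologicalSpace D] (l : ℕ)
    {c : CuspNumberData D} (hc : ∀ V, c.r V = 0) (V J : Subgroup D) :
    ¬ TotallyRamifiedCriterion l c V J := by
  rintro ⟨W, -, -, -, hlt⟩
  rw [hc W, hc V, mul_zero] at hlt
  exact Nat.lt_irrefl 0 hlt

/-- With a CONSTANT positive cusp-number function `r ≡ n` (`n ≥ 1`) the numerical clause `r_W < l · r_V` of the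
criterion holds iff `2 ≤ l`; so for `l ≥ 2` the criterion reduces to the existence of an intermediate subgroup
`J ≤ W ≤ V` of relative index `l` (honest label: a bookkeeping fact about the typed predicate, not about
curves — a constant `r` is not the cusp count of a tower). [cite: MochizukiAbsAnab2004, Lemma 1.3.9 p.19] -/
theorem totallyRamifiedCriterion_iff_of_r_const {D : Type u} [Group D] [TopologicalSpace D] {l n : ℕ}
    (hl : 2 ≤ l) (hn : 0 < n) {c : CuspNumberData D} (hc : ∀ V, c.r V = n) (V J : Subgroup D) :
    TotallyRamifiedCriterion l c V J ↔ ∃ W : Subgroup D, J ≤ W ∧ W ≤ V ∧ W.relIndex V = l := by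
  constructor
  · rintro ⟨W, hJW, hWV, hidx, -⟩
    exact ⟨W, hJW, hWV, hidx⟩
  · rintro ⟨W, hJW, hWV, hidx⟩
    refine ⟨W, hJW, hWV, hidx, ?_⟩
    rw [hc W, hc V]
    calc n = 1 * n := (one_mul n).symm
      _ < l * n := Nat.mul_lt_mul_of_pos_right (by omega) hn

end FundamentalExtension

end Literature.AnabelianGeometry.AbsoluteAnabelian
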